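import Literature.Analysis.FluidPDE.DeRosaGluedStressSize
import Literature.Analysis.FluidPDE.OnsagerBDSVGluedStressTransport
import HarnessLib

/-!
# De Rosa's gluing stage, Prop. 5.5: the bound (5.17) on the transport derivative of the glued stress

L. De Rosa, *Infinitely many Leray–Hopf solutions for the fractional Navier–Stokes equations*,
Comm. PDE 44 (2019) 335–365 = arXiv:1801.10235, §5.2, Prop. 5.5, (5.17):
"`‖(∂ₜ + v̄_q·∇)R̊̄_q‖_{N+α} ≲ δ_{q+1} δ_q^{1/2} λ_q ℓ^{-N-α}`", whose proof is "consequence of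
Propositions 5.3 and 5.4 (the proof can be found in [BDLSV2017])" — i.e. BDSV Prop. 4.3, (4.8)
(`OnsagerBDSVGluedStressTransport.lean`): differentiate
`R̊̄_q = ∂ₜχᵢ ℛ(vᵢ - vᵢ₊₁) - χᵢ(1-χᵢ)(vᵢ - vᵢ₊₁) ⊗̊ (vᵢ - vᵢ₊₁)` along `∂ₜ + v̄_q·∇`, write
`v̄_q = v_ℓ + (v̄_q - v_ℓ)`, `vᵢ - vᵢ₊₁ = curl(zᵢ - zᵢ₊₁)`, use the commutator estimate for
`[v_ℓ·∇, ℛ curl]` (BDSV App. D), the transported stability bounds (5.12) for `D_{t,ℓ}(vᵢ - v_ℓ)` and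
(5.24) for `D_{t,ℓ}(zᵢ - zᵢ₊₁)`, and `‖∂ₜᴺχᵢ‖₀ ≲ τ_q^{-N}`.

For the glued triple of a `DeRosa.IsGlueFamily` (`DeRosaGluedTriple.lean`) whose members obey the
stability bounds (5.10)–(5.12) and the vector-potential bounds (5.23)–(5.24) in the form
`BDSV.StabilityBounds` / `BDSV.PotentialBounds` (constant `C₃`), this file proves the twins of the
theorems of the BDSV file, with the same explicit constants (the generic lemmas of that file —
interval calculus of `advectiveDerivWithin`, `Torus.timeDerivWithin_antidivergence_curl_comm`,
`BDSV.advectiveDerivWithin_antidivergence_eq`, the cut-off bounds `BDSV.abs_deriv_stepDeriv_le`,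
`BDSV.abs_deriv_stepWeight_le`, the parameter conversions, `BDSV.eContDiffHolderNorm_comb₆_le` — are
reused):

* `DeRosa.IsGlueFamily.hasDerivWithinAt_gluedStress`, `….timeDerivWithin_gluedStress`,
  `….advectiveDeriv_gluedStress` — `(∂ₜ + u·∇)R̊̄ = θ''ℛ(wᵢ) + θ'D_tℛ(wᵢ) - (θ(1-θ))'wᵢ ⊗̊ wᵢ - θ(1-θ)D_t(wᵢ ⊗̊ wᵢ)`;
* `DeRosa.IsGlueFamily.eContDiffHolderNorm_transport_velDiff_le` ((5.12) for `wᵢ`),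
  `….eContDiffHolderNorm_transport_biotSavart_le` ((5.24)), `….eContDiffHolderNorm_commutator_le`
  (the commutator term, given a commutator constant, cf. `BDSV.commutatorCZBound`),
  `….eContDiffHolderNorm_transition_transport_le`, `….eContDiffHolderNorm_convect_gluedStress_le`;
* `DeRosa.IsGlueFamily.eContDiffHolderNorm_advectiveDeriv_gluedStress_le` — **(5.17)** at a fixed
  time with an explicit constant, for `N ≤ N̄` given the bounds for `N ≤ N̄ + 2`.

The proofs are those of the BDSV file for the De Rosa family (they use the equations only through
the hypotheses `BDSV.StabilityBounds.transport`, `BDSV.PotentialBounds.transport`). On the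
duplication with `OnsagerBDSVGluedStressTransport.lean`: the formulas for `∂ₜR̊̄` and `(∂ₜ + u·∇)R̊̄`
(`hasDerivWithinAt_gluedStress`, `timeDerivWithin_gluedStress`, `advectiveDeriv_gluedStress`) have the
same statements as their `BDSV.IsGlueFamily` twins but concern the De Rosa family (exact fractional
Navier–Stokes solutions, to which the BDSV lemmas do not apply); the family-independent cut-off
lemmas are taken from the grid (`DeRosa.IsGlueFamily.grid`) and not restated.

## References

* L. De Rosa, Comm. PDE 44 (2019) = arXiv:1801.10235, §5.2 Prop. 5.5 (5.17), Prop. 5.3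
  (5.10)–(5.12), Prop. 5.4 (5.23)–(5.24), the cut-offs `χᵢ`. [`Derosa2018`]
* T. Buckmaster, C. De Lellis, L. Székelyhidi Jr., V. Vicol, CPAM 72 (2019) = arXiv:1701.08678,
  §4.4 Prop. 4.3 (4.8), App. D Prop. D.1. [`BuckmasterEtAl2018`]
-/

noncomputable section

open MeasureTheory Set Filter Topology Function
open scoped NNReal ENNReal ContDiff

namespace Literature.Analysis.FluidPDE

namespace DeRosa

open FunctionSpaces FunctionSpaces.Torus
open BDSV hiding IsGlueFamily

/-! ## The transport derivative of the glued stress -/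

section GluedStressDerivDR


variable {γ ν T τ : ℝ} {n : ℕ} {vℓ : ℝ → UnitAddTorus (Fin 3) → EuclideanSpace ℝ (Fin 3)} {pℓ : ℝ → UnitAddTorus (Fin 3) → ℝ}
  {Rℓ : ℝ → UnitAddTorus (Fin 3) → Fin 3 → EuclideanSpace ℝ (Fin 3)}
  {v : ℕ → ℝ → UnitAddTorus (Fin 3) → EuclideanSpace ℝ (Fin 3)} {p : ℕ → ℝ → UnitAddTorus (Fin 3) → ℝ}
  (h : IsGlueFamily γ ν T τ n vℓ pℓ Rℓ v p)
include h

variable {i k : ℕ} {t : ℝ}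

/-- **The time derivative of `R̊̄` within `[0,T]`** at a time of `[t_i, t_i + τ]`: for `i < n`,
`∂ₜR̊̄ = θ'' ℛ(wᵢ) + θ' ∂ₜℛ(wᵢ) - (θ(1-θ))' wᵢ ⊗̊ wᵢ - θ(1-θ) ∂ₜ(wᵢ ⊗̊ wᵢ)`, the inner time
derivatives within `[t_i, t_i + τ]`; for `i = n` it vanishes (BDSV §4.4, the first lines of the
computation of `D_{t,ℓ}R̊̄_q`). [cite: Derosa2018, §5.2 Prop. 5.5 (5.17)] -/
theorem IsGlueFamily.hasDerivWithinAt_gluedStress (ht : t ∈ Icc ((i : ℝ) * τ) ((i : ℝ) * τ + τ))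
    (htT : t ∈ Icc 0 T) (x : UnitAddTorus (Fin 3)) :
    HasDerivWithinAt (fun s => gluedStress τ n v s x)
      (if i < n then
        deriv (stepDeriv τ n i) t • Torus.antidivergence (velDiff v i t) x +
            stepDeriv τ n i t • FunctionSpaces.Torus.timeDerivWithin (Icc ((i : ℝ) * τ) ((i : ℝ) * τ + τ))
              (fun s => Torus.antidivergence (velDiff v i s)) t x -
          (deriv (stepWeight τ n i) t • Torus.tracelessSq (velDiff v i t) x +
            stepWeight τ n i t • FunctionSpaces.Torus.timeDerivWithin (Icc ((i : ℝ) * τ) ((i : ℝ) * τ + τ))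
              (fun s => Torus.tracelessSq (velDiff v i s)) t x)
        else 0) (Icc 0 T) t := by
  -- term-wise derivatives of the global sum
  set D : ℕ → (Fin 3 → EuclideanSpace ℝ (Fin 3)) := fun k =>
    deriv (stepDeriv τ n k) t • Torus.antidivergence (velDiff v k t) x +
        stepDeriv τ n k t • FunctionSpaces.Torus.timeDerivWithin (Icc ((k : ℝ) * τ) ((k : ℝ) * τ + τ))
          (fun s => Torus.antidivergence (velDiff v k s)) t x -
      (deriv (stepWeight τ n k) t • Torus.tracelessSq (velDiff v k t) x +
        stepWeight τ n k t • FunctionSpaces.Torus.timeDerivWithin (Icc ((k : ℝ) * τ) ((k : ℝ) * τ + τ))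
          (fun s => Torus.tracelessSq (velDiff v k s)) t x) with hD
  have hsum : HasDerivWithinAt (fun s => ∑ k ∈ Finset.range n,
      (stepDeriv τ n k s • Torus.antidivergence (velDiff v k s) x - stepWeight τ n k s • Torus.tracelessSq (velDiff v k s) x))
      (∑ k ∈ Finset.range n, D k) (Icc 0 T) t := by
    refine HasDerivWithinAt.fun_sum fun k hk => ?_
    have hk' := Finset.mem_range.1 hk
    exact ((h.isTimeCutoff_stepDeriv hk').hasDerivWithinAt_smul (h.smooth_antidivergence hk') htT x).sub
      ((h.isTimeCutoff_stepWeight hk').hasDerivWithinAt_smul (h.smooth_tracelessSq hk') htT x)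
  have e : (fun s => gluedStress τ n v s x) = fun s => ∑ k ∈ Finset.range n,
      (stepDeriv τ n k s • Torus.antidivergence (velDiff v k s) x - stepWeight τ n k s • Torus.tracelessSq (velDiff v k s) x) := by
    funext s
    funext j
    simp [gluedStress, Finset.sum_apply]
  have hcoll : ∑ k ∈ Finset.range n, D k = if i < n then D i else 0 := by
    refine sum_range_collapse D fun k hk hki => ?_
    have hkn := Finset.mem_range.1 hk
    obtain ⟨h1, h2⟩ := h.step_inactive hkn hki ht
    obtain ⟨h3, h4⟩ := h.grid.step_inactive_deriv hkn hki ht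
    simp only [hD, h1, h2, h3, h4, zero_smul, add_zero, sub_zero]
  rw [e]
  rw [hcoll] at hsum
  exact hsum

/-- The time derivative of `R̊̄` within `[0,T]` at a time of `[t_i, t_i + τ]` (the `derivWithin`
form of `hasDerivWithinAt_gluedStress`). [cite: Derosa2018, §5.2 Prop. 5.5 (5.17)] -/
theorem IsGlueFamily.timeDerivWithin_gluedStress (ht : t ∈ Icc ((i : ℝ) * τ) ((i : ℝ) * τ + τ))
    (htT : t ∈ Icc 0 T) (x : UnitAddTorus (Fin 3)) :
    FunctionSpaces.Torus.timeDerivWithin (Icc 0 T) (gluedStress τ n v) t x =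
      if i < n then
        deriv (stepDeriv τ n i) t • Torus.antidivergence (velDiff v i t) x +
            stepDeriv τ n i t • FunctionSpaces.Torus.timeDerivWithin (Icc ((i : ℝ) * τ) ((i : ℝ) * τ + τ))
              (fun s => Torus.antidivergence (velDiff v i s)) t x -
          (deriv (stepWeight τ n i) t • Torus.tracelessSq (velDiff v i t) x +
            stepWeight τ n i t • FunctionSpaces.Torus.timeDerivWithin (Icc ((i : ℝ) * τ) ((i : ℝ) * τ + τ))
              (fun s => Torus.tracelessSq (velDiff v i s)) t x)
        else 0 :=
  (h.hasDerivWithinAt_gluedStress ht htT x).derivWithin (uniqueDiffOn_Icc h.hT t htT)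

/-- **The transport derivative `(∂ₜ + u·∇)R̊̄` of the glued stress along any velocity field `u`**
at a time of `[t_i, t_i + τ] ∩ [0,T]`: for `i < n`,
`(∂ₜ + u·∇)R̊̄ = θ'' ℛ(wᵢ) + θ' D_t ℛ(wᵢ) - (θ(1-θ))' wᵢ ⊗̊ wᵢ - θ(1-θ) D_t(wᵢ ⊗̊ wᵢ)` with
`D_t = ∂ₜ + u·∇` taken within `[t_i, t_i + τ]`; `0` for `i = n` (BDSV §4.4, the computation of
`D_{t,ℓ}R̊̄_q`, first and fourth lines). [cite: Derosa2018, §5.2 Prop. 5.5 (5.17)] -/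
theorem IsGlueFamily.advectiveDeriv_gluedStress (ht : t ∈ Icc ((i : ℝ) * τ) ((i : ℝ) * τ + τ))
    (htT : t ∈ Icc 0 T) (u : ℝ → UnitAddTorus (Fin 3) → EuclideanSpace ℝ (Fin 3)) (x : UnitAddTorus (Fin 3)) :
    advectiveDeriv T u (gluedStress τ n v) t x =
      if i < n then
        deriv (stepDeriv τ n i) t • Torus.antidivergence (velDiff v i t) x +
            stepDeriv τ n i t • advectiveDerivWithin (Icc ((i : ℝ) * τ) ((i : ℝ) * τ + τ)) u
              (fun s => Torus.antidivergence (velDiff v i s)) t x -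
          (deriv (stepWeight τ n i) t • Torus.tracelessSq (velDiff v i t) x +
            stepWeight τ n i t • advectiveDerivWithin (Icc ((i : ℝ) * τ) ((i : ℝ) * τ + τ)) u
              (fun s => Torus.tracelessSq (velDiff v i s)) t x)
        else 0 := by
  rw [show advectiveDeriv T u (gluedStress τ n v) t x = FunctionSpaces.Torus.timeDerivWithin (Icc 0 T) (gluedStress τ n v) t x +
      FunctionSpaces.Torus.convect (u t) (gluedStress τ n v t) x from rfl,
    h.timeDerivWithin_gluedStress ht htT x, h.gluedStress_eq ht]
  split_ifs with hi
  · have hw := h.isSmooth_velDiff hi ht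
    have hA1 : IsContDiff 1 (fun y => Torus.antidivergence (velDiff v i t) y) :=
      (Torus.isSmooth_antidivergence hw).isContDiff (by simp)
    have hQ1 : IsContDiff 1 (Torus.tracelessSq (velDiff v i t)) := hw.tracelessSq.isContDiff (by simp)
    rw [convect_sub_right (hA1.smul _) (hQ1.smul _),
      show stepDeriv τ n i t • (fun y => Torus.antidivergence (velDiff v i t) y) =
        fun y => stepDeriv τ n i t • Torus.antidivergence (velDiff v i t) y from rfl,
      show stepWeight τ n i t • Torus.tracelessSq (velDiff v i t) =
        fun y => stepWeight τ n i t • Torus.tracelessSq (velDiff v i t) y from rfl,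
      Torus.convect_smul_right _ hA1, Torus.convect_smul_right _ hQ1, advectiveDerivWithin_apply, advectiveDerivWithin_apply]
    simp only [smul_add]
    abel
  · rw [convect_zero_field, add_zero]

end GluedStressDerivDR

/-! ## Prop. 5.5, (5.17): ingredients of the bound on `(∂ₜ + v̄·∇)R̊̄` -/

section TransportIngredientsDR

variable {γ ν β α a b T C₃ : ℝ} {q n Nb : ℕ} {vℓ : ℝ → UnitAddTorus (Fin 3) → EuclideanSpace ℝ (Fin 3)}
  {pℓ : ℝ → UnitAddTorus (Fin 3) → ℝ} {Rℓ : ℝ → UnitAddTorus (Fin 3) → Fin 3 → EuclideanSpace ℝ (Fin 3)}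
  {v : ℕ → ℝ → UnitAddTorus (Fin 3) → EuclideanSpace ℝ (Fin 3)} {p : ℕ → ℝ → UnitAddTorus (Fin 3) → ℝ}

/-- The vector potential `s ↦ ℬ wᵢ(s)` is jointly smooth on `[tᵢ, tᵢ + τ]` (`i < n`). [folklore] -/
theorem IsGlueFamily.smooth_biotSavart_velDiff {τ : ℝ} (h : IsGlueFamily γ ν T τ n vℓ pℓ Rℓ v p) {i : ℕ} (hi : i < n) :
    FunctionSpaces.Torus.IsSmoothSpaceTimeOn (Icc ((i : ℝ) * τ) ((i : ℝ) * τ + τ))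
      (fun s x => BDSV.biotSavart (fun y => v i s y - v (i + 1) s y) x) := by
  have hint : (interior (Icc ((i : ℝ) * τ) ((i : ℝ) * τ + τ))).Nonempty := by
    rw [interior_Icc]; exact nonempty_Ioo.2 (by linarith [h.hτ])
  exact isSmoothSpaceTimeOn_biotSavart (h.smooth_velDiff hi) (convex_Icc _ _) hint

/-- `vᵢ - v_ℓ` is jointly smooth on the closed life span of `vᵢ` (`i ≤ n`). [folklore] -/
theorem IsGlueFamily.smooth_v_sub_vℓ {τ : ℝ} (h : IsGlueFamily γ ν T τ n vℓ pℓ Rℓ v p) {i : ℕ} (hi : i ≤ n) :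
    FunctionSpaces.Torus.IsSmoothSpaceTimeOn (Icc (max ((i : ℝ) * τ - τ) 0) (min ((i : ℝ) * τ + τ) T))
      (fun s y => v i s y - vℓ s y) := by
  have hsub : Icc (max ((i : ℝ) * τ - τ) 0) (min ((i : ℝ) * τ + τ) T) ⊆ Icc 0 T := by
    rw [← glueInterval_eq_Icc]; exact glueInterval_subset_Icc T τ i
  exact (h.smooth_v hi).sub (h.nsr.smooth_velocity.mono hsub)

/-- **The transport derivative of `wᵢ` along `v_ℓ`** on `[tᵢ, tᵢ + τ]` is the difference of those
of `vᵢ - v_ℓ` and `vᵢ₊₁ - v_ℓ` on their life spans (restricted). [folklore] -/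
theorem IsGlueFamily.advectiveDerivWithin_velDiff_eq {τ : ℝ} (h : IsGlueFamily γ ν T τ n vℓ pℓ Rℓ v p) {i : ℕ} (hi : i < n)
    {t : ℝ} (ht : t ∈ Icc ((i : ℝ) * τ) ((i : ℝ) * τ + τ)) (x : UnitAddTorus (Fin 3)) :
    advectiveDerivWithin (Icc ((i : ℝ) * τ) ((i : ℝ) * τ + τ)) vℓ (velDiff v i) t x =
      advectiveDerivWithin (glueInterval T τ i) vℓ (fun s y => v i s y - vℓ s y) t x -
        advectiveDerivWithin (glueInterval T τ (i + 1)) vℓ (fun s y => v (i + 1) s y - vℓ s y) t x := by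
  have hlt : (i : ℝ) * τ < (i : ℝ) * τ + τ := by linarith [h.hτ]
  have hS : UniqueDiffOn ℝ (Icc ((i : ℝ) * τ) ((i : ℝ) * τ + τ)) := uniqueDiffOn_Icc hlt
  obtain ⟨h1, h2⟩ := h.Icc_subset_glueInterval hi
  have hf := h.smooth_v_sub_vℓ hi.le
  have hg := h.smooth_v_sub_vℓ (Nat.succ_le_of_lt hi)
  rw [← glueInterval_eq_Icc] at hf hg
  have e : velDiff v i = fun s y => (v i s y - vℓ s y) - (v (i + 1) s y - vℓ s y) := by
    funext s y; simp [velDiff]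
  rw [e, advectiveDerivWithin_sub hS (hf.mono h1) (hg.mono h2) ht x]
  rw [glueInterval_eq_Icc] at hf hg h1 h2 ⊢
  rw [glueInterval_eq_Icc, advectiveDerivWithin_Icc_of_subset hlt h1 hf ht x, advectiveDerivWithin_Icc_of_subset hlt h2 hg ht x]

/-- **(3.12) transported**: `‖D_{t,ℓ} wᵢ(t)‖_{m+α} ≤ 2|C₃| δ_{q+1} ℓ^{-m-1+α}` on `[tᵢ, tᵢ + τ]`, `i < n`,
`m ≤ N̄` (third bound of Prop. 3.3 for `vᵢ` and `vᵢ₊₁`). [cite: Derosa2018, §5.2 Prop. 5.3 (5.12)] -/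
theorem IsGlueFamily.eContDiffHolderNorm_transport_velDiff_le (h : IsGlueFamily γ ν T (glueScale β α a b q) n vℓ pℓ Rℓ v p)
    (hS : ∀ i : ℕ, i ≤ n → StabilityBounds β α a b T C₃ q Nb i vℓ pℓ (v i) (p i)) (ha : 1 ≤ a)
    {i : ℕ} (hi : i < n) {t : ℝ} (ht : t ∈ Icc ((i : ℝ) * glueScale β α a b q) ((i : ℝ) * glueScale β α a b q + glueScale β α a b q))
    {m : ℕ} (hm : m ≤ Nb) :
    Torus.eContDiffHolderNorm m (Real.toNNReal α)
        (advectiveDerivWithin (Icc ((i : ℝ) * glueScale β α a b q) ((i : ℝ) * glueScale β α a b q + glueScale β α a b q)) vℓ (velDiff v i) t) ≤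
      ENNReal.ofReal (2 * |C₃| * (amp β a b (q + 1) * mollScale β α a b q ^ (-(m : ℝ) - 1 + α))) := by
  set τ := glueScale β α a b q with hτ
  set X := amp β a b (q + 1) * mollScale β α a b q ^ (-(m : ℝ) - 1 + α) with hX
  have hX0 : 0 ≤ X := by
    have h2 := amp_pos (β := β) (b := b) ha (q + 1)
    have h3 := mollScale_pos (β := β) (α := α) (b := b) ha q
    positivity
  have hti : t ∈ glueInterval T τ i := (h.Icc_subset_glueInterval hi).1 ht
  have hti' : t ∈ glueInterval T τ (i + 1) := (h.Icc_subset_glueInterval hi).2 ht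
  have hmono : ENNReal.ofReal (C₃ * X) ≤ ENNReal.ofReal (|C₃| * X) :=
    ENNReal.ofReal_le_ofReal (mul_le_mul_of_nonneg_right (le_abs_self _) hX0)
  have hf := ((hS i hi.le).transport m hm t hti).trans hmono
  have hg := ((hS (i + 1) (Nat.succ_le_of_lt hi)).transport m hm t hti').trans hmono
  have e : advectiveDerivWithin (Icc ((i : ℝ) * τ) ((i : ℝ) * τ + τ)) vℓ (velDiff v i) t =
      advectiveDerivWithin (glueInterval T τ i) vℓ (fun s y => v i s y - vℓ s y) t -
        advectiveDerivWithin (glueInterval T τ (i + 1)) vℓ (fun s y => v (i + 1) s y - vℓ s y) t :=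
    funext fun x => h.advectiveDerivWithin_velDiff_eq hi ht x
  -- smoothness of the two transport derivatives
  have hlt : (i : ℝ) * τ < (i : ℝ) * τ + τ := by linarith [h.hτ]
  have hsm : ∀ {j : ℕ} (hj : j ≤ n), t ∈ glueInterval T τ j →
      IsContDiff m (advectiveDerivWithin (glueInterval T τ j) vℓ (fun s y => v j s y - vℓ s y) t) := by
    intro j hj htj
    have hF := h.smooth_v_sub_vℓ hj
    rw [← glueInterval_eq_Icc] at hF
    have hU : UniqueDiffOn ℝ (glueInterval T τ j) := uniqueDiffOn_glueInterval h.hT h.hτ (h.anchor_le hj)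
    have h1 : IsSmooth (FunctionSpaces.Torus.timeDerivWithin (glueInterval T τ j) (fun s y => v j s y - vℓ s y) t) :=
      (hF.timeDerivWithin hU).isSmooth_slice htj
    have h2 : IsSmooth (FunctionSpaces.Torus.convect (vℓ t) (fun y => v j t y - vℓ t y)) :=
      (h.isSmooth_vℓ (glueInterval_subset_Icc T τ j htj)).convect (hF.isSmooth_slice htj)
    exact (h1.add h2).isContDiff (mod_cast le_top)
  rw [e]
  calc Torus.eContDiffHolderNorm m (Real.toNNReal α)
        (advectiveDerivWithin (glueInterval T τ i) vℓ (fun s y => v i s y - vℓ s y) t -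
          advectiveDerivWithin (glueInterval T τ (i + 1)) vℓ (fun s y => v (i + 1) s y - vℓ s y) t)
      ≤ Torus.eContDiffHolderNorm m (Real.toNNReal α) (advectiveDerivWithin (glueInterval T τ i) vℓ (fun s y => v i s y - vℓ s y) t) +
          Torus.eContDiffHolderNorm m (Real.toNNReal α) (advectiveDerivWithin (glueInterval T τ (i + 1)) vℓ (fun s y => v (i + 1) s y - vℓ s y) t) :=
        Torus.eContDiffHolderNorm_sub_le (hsm hi.le hti) (hsm (Nat.succ_le_of_lt hi) hti')
    _ ≤ ENNReal.ofReal (|C₃| * X) + ENNReal.ofReal (|C₃| * X) := add_le_add hf hg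
    _ = ENNReal.ofReal (2 * |C₃| * X) := by
        rw [← ENNReal.ofReal_add (by positivity) (by positivity)]; ring_nf

/-- **(3.17) transported**: `‖D_{t,ℓ} ℬwᵢ(t)‖_{m+α} ≤ |C₃| δ_{q+1} ℓ^{-m+α}` on `[tᵢ, tᵢ + τ]`, `i < n`,
`m ≤ N̄` (second bound of Prop. 3.4). [cite: Derosa2018, §5.2 Prop. 5.4 (5.24)] -/
theorem IsGlueFamily.eContDiffHolderNorm_transport_biotSavart_le (h : IsGlueFamily γ ν T (glueScale β α a b q) n vℓ pℓ Rℓ v p)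
    (hP : ∀ i : ℕ, i < n → PotentialBounds β α a b T C₃ q Nb i vℓ (v i) (v (i + 1))) (ha : 1 ≤ a)
    {i : ℕ} (hi : i < n) {t : ℝ} (ht : t ∈ Icc ((i : ℝ) * glueScale β α a b q) ((i : ℝ) * glueScale β α a b q + glueScale β α a b q))
    {m : ℕ} (hm : m ≤ Nb) :
    Torus.eContDiffHolderNorm m (Real.toNNReal α)
        (advectiveDerivWithin (Icc ((i : ℝ) * glueScale β α a b q) ((i : ℝ) * glueScale β α a b q + glueScale β α a b q)) vℓ
          (fun s x => BDSV.biotSavart (fun y => v i s y - v (i + 1) s y) x) t) ≤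
      ENNReal.ofReal (|C₃| * (amp β a b (q + 1) * mollScale β α a b q ^ (-(m : ℝ) + α))) := by
  set X := amp β a b (q + 1) * mollScale β α a b q ^ (-(m : ℝ) + α) with hX
  have hX0 : 0 ≤ X := by
    have h2 := amp_pos (β := β) (b := b) ha (q + 1)
    have h3 := mollScale_pos (β := β) (α := α) (b := b) ha q
    positivity
  have hb := (hP i hi).transport m hm
  rw [h.glueInterval_inter_succ hi] at hb
  exact (hb t ht).trans (ENNReal.ofReal_le_ofReal (mul_le_mul_of_nonneg_right (le_abs_self _) hX0))


end TransportIngredientsDR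

/-! ## Prop. 5.5, (5.17): the bound on `(∂ₜ + v̄·∇)R̊̄` -/

section TransportBoundDR

variable {γ ν β α a b T C₃ : ℝ} {q n Nb : ℕ} {vℓ : ℝ → UnitAddTorus (Fin 3) → EuclideanSpace ℝ (Fin 3)}
  {pℓ : ℝ → UnitAddTorus (Fin 3) → ℝ} {Rℓ : ℝ → UnitAddTorus (Fin 3) → Fin 3 → EuclideanSpace ℝ (Fin 3)}
  {v : ℕ → ℝ → UnitAddTorus (Fin 3) → EuclideanSpace ℝ (Fin 3)} {p : ℕ → ℝ → UnitAddTorus (Fin 3) → ℝ} {Cin : ℕ → ℝ}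
  {B : EuclideanSpace ℝ (Fin 3) →L[ℝ] EuclideanSpace ℝ (Fin 3) →L[ℝ] (Fin 3 → EuclideanSpace ℝ (Fin 3))}


/-- **The commutator term** `[v_ℓ·∇, ℛ curl](zᵢ - zᵢ₊₁)` at a time of `[tᵢ, tᵢ + τ]` (`i < n`): with a
commutator constant `C_cm` at order `N` (App. D, Prop. D.1) and the interpolated (2.13),
`‖[v_ℓ(t)·∇, ℛ curl] ℬwᵢ(t)‖_{N+α} ≤ C_cm (V₀ + V_N) |C₃| δ_{q+1} ℓ^{-N+α}`,
`V_m = (m+4)|C_in(m)| + |C_in(m+1)|` (BDSV: "`τ_q⁻¹‖v_ℓ‖_{1+α}‖zᵢ-zᵢ₊₁‖_{N+α} + τ_q⁻¹‖v_ℓ‖_{N+1+α}‖zᵢ-zᵢ₊₁‖_α`",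
here without the factor `τ_q⁻¹ = |∂ₜχᵢ|`). [cite: Derosa2018, §5.2 Prop. 5.5 (5.17)] [cite: BuckmasterEtAl2018, App. D Prop. D.1] -/
theorem IsGlueFamily.eContDiffHolderNorm_commutator_le
    (h : IsGlueFamily γ ν T (glueScale β α a b q) n vℓ pℓ Rℓ v p)
    (hP : ∀ i : ℕ, i < n → PotentialBounds β α a b T C₃ q Nb i vℓ (v i) (v (i + 1)))
    (ha : 1 ≤ a) (hb : 1 ≤ b) (hβ : 0 ≤ β) (hα : 0 < α) (hα1 : α < 1)
    (h213 : ∀ N : ℕ, HolderSupLE T vℓ (N + 1) 0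
      (Cin N * (Real.sqrt (amp β a b q) * freq a b q * mollScale β α a b q ^ (-(N : ℝ)))))
    {N : ℕ} (hN : N ≤ Nb) {Ccm : ℝ≥0∞}
    (hcm : ∀ bb z : UnitAddTorus (Fin 3) → EuclideanSpace ℝ (Fin 3), IsSmooth bb → IsSmooth z →
      Torus.eContDiffHolderNorm N (Real.toNNReal α)
          (fun x => FunctionSpaces.Torus.convect bb (fun y => Torus.antidivergence (BDSV.curl z) y) x -
            Torus.antidivergence (BDSV.curl (FunctionSpaces.Torus.convect bb z)) x) ≤
        Ccm * (Torus.eContDiffHolderNorm 1 (Real.toNNReal α) bb * Torus.eContDiffHolderNorm N (Real.toNNReal α) z +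
          Torus.eContDiffHolderNorm (N + 1) (Real.toNNReal α) bb * Torus.eContDiffHolderNorm 0 (Real.toNNReal α) z))
    {i : ℕ} (hi : i < n) {t : ℝ} (ht : t ∈ Icc ((i : ℝ) * glueScale β α a b q) ((i : ℝ) * glueScale β α a b q + glueScale β α a b q))
    (htT : t ∈ Icc 0 T) :
    Torus.eContDiffHolderNorm N (Real.toNNReal α)
        (fun x => FunctionSpaces.Torus.convect (vℓ t) (fun y => Torus.antidivergence (BDSV.curl (BDSV.biotSavart (velDiff v i t))) y) x -
          Torus.antidivergence (BDSV.curl (FunctionSpaces.Torus.convect (vℓ t) (BDSV.biotSavart (velDiff v i t)))) x) ≤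
      Ccm * ENNReal.ofReal (((((0 : ℕ) : ℝ) + 4) * |Cin 0| + |Cin (0 + 1)| + ((((N : ℕ) : ℝ) + 4) * |Cin N| + |Cin (N + 1)|)) * |C₃| *
        (amp β a b (q + 1) * mollScale β α a b q ^ (-(N : ℝ) + α))) := by
  set τ := glueScale β α a b q with hτdef
  set δ := amp β a b (q + 1) with hδdef
  set ℓ := mollScale β α a b q with hℓdef
  set Aq := Real.sqrt (amp β a b q) * freq a b q with hAqdef
  have hτ : 0 < τ := h.hτ
  have hδ : 0 < δ := amp_pos ha (q + 1)
  have hℓ : 0 < ℓ := mollScale_pos ha q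
  have hℓ1 : ℓ ≤ 1 := mollScale_le_one ha hb hβ hα.le q
  have hAq : 0 < Aq := mul_pos (Real.sqrt_pos.2 (amp_pos ha q)) (freq_pos ha q)
  set V₀ : ℝ := (((0 : ℕ) : ℝ) + 4) * |Cin 0| + |Cin (0 + 1)| with hV₀
  set V₁ : ℝ := (((N : ℕ) : ℝ) + 4) * |Cin N| + |Cin (N + 1)| with hV₁
  have hV₀0 : 0 ≤ V₀ := by positivity
  have hV₁0 : 0 ≤ V₁ := by positivity
  have hsm : ∀ s ∈ Icc 0 T, IsSmooth (vℓ s) := fun s hs => h.isSmooth_vℓ hs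
  have hvℓt : IsSmooth (vℓ t) := hsm t htT
  have hzt : IsSmooth (BDSV.biotSavart (velDiff v i t)) := isSmooth_biotSavart (h.isSmooth_velDiff hi ht)
  have hb1 : Torus.eContDiffHolderNorm 1 (Real.toNNReal α) (vℓ t) ≤ ENNReal.ofReal (V₀ * (Aq * ℓ ^ (-((0 : ℕ) : ℝ) - α))) :=
    eContDiffHolderNorm_succ_le_of_holderSupLE hα hα1 hℓ hℓ1 hAq.le hsm h213 htT 0
  have hb2 : Torus.eContDiffHolderNorm (N + 1) (Real.toNNReal α) (vℓ t) ≤ ENNReal.ofReal (V₁ * (Aq * ℓ ^ (-(N : ℝ) - α))) :=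
    eContDiffHolderNorm_succ_le_of_holderSupLE hα hα1 hℓ hℓ1 hAq.le hsm h213 htT N
  have hz1 : Torus.eContDiffHolderNorm N (Real.toNNReal α) (BDSV.biotSavart (velDiff v i t)) ≤ ENNReal.ofReal (|C₃| * (τ * δ * ℓ ^ (-(N : ℝ) + α))) :=
    h.eContDiffHolderNorm_biotSavart_velDiff_le hP ha hi ht hN
  have hz2 : Torus.eContDiffHolderNorm 0 (Real.toNNReal α) (BDSV.biotSavart (velDiff v i t)) ≤ ENNReal.ofReal (|C₃| * (τ * δ * ℓ ^ (-((0 : ℕ) : ℝ) + α))) :=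
    h.eContDiffHolderNorm_biotSavart_velDiff_le hP ha hi ht (Nat.zero_le _)
  refine (hcm (vℓ t) (BDSV.biotSavart (velDiff v i t)) hvℓt hzt).trans (mul_le_mul' le_rfl ?_)
  -- the real-number conversions `Aq τ ℓ^{-N} ≤ ℓ^{-N+α}`
  have hconv : τ * Aq * ℓ ^ (-(N : ℝ)) ≤ ℓ ^ (-(N : ℝ) + α) := by
    have := glueScale_mul_sqrt_amp_mul_freq_mul_rpow_le (β := β) (α := α) ha hb hβ hα.le q (N : ℝ)
    simpa [hAqdef, mul_assoc] using this
  have e1 : V₀ * (Aq * ℓ ^ (-((0 : ℕ) : ℝ) - α)) * (|C₃| * (τ * δ * ℓ ^ (-(N : ℝ) + α))) =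
      V₀ * |C₃| * δ * (τ * Aq * ℓ ^ (-(N : ℝ))) := by
    have : ℓ ^ (-((0 : ℕ) : ℝ) - α) * ℓ ^ (-(N : ℝ) + α) = ℓ ^ (-(N : ℝ)) := by
      rw [← Real.rpow_add hℓ]; congr 1; push_cast; ring
    calc V₀ * (Aq * ℓ ^ (-((0 : ℕ) : ℝ) - α)) * (|C₃| * (τ * δ * ℓ ^ (-(N : ℝ) + α)))
        = V₀ * |C₃| * δ * (τ * Aq * (ℓ ^ (-((0 : ℕ) : ℝ) - α) * ℓ ^ (-(N : ℝ) + α))) := by ring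
      _ = _ := by rw [this]
  have e2 : V₁ * (Aq * ℓ ^ (-(N : ℝ) - α)) * (|C₃| * (τ * δ * ℓ ^ (-((0 : ℕ) : ℝ) + α))) =
      V₁ * |C₃| * δ * (τ * Aq * ℓ ^ (-(N : ℝ))) := by
    have : ℓ ^ (-(N : ℝ) - α) * ℓ ^ (-((0 : ℕ) : ℝ) + α) = ℓ ^ (-(N : ℝ)) := by
      rw [← Real.rpow_add hℓ]; congr 1; push_cast; ring
    calc V₁ * (Aq * ℓ ^ (-(N : ℝ) - α)) * (|C₃| * (τ * δ * ℓ ^ (-((0 : ℕ) : ℝ) + α)))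
        = V₁ * |C₃| * δ * (τ * Aq * (ℓ ^ (-(N : ℝ) - α) * ℓ ^ (-((0 : ℕ) : ℝ) + α))) := by ring
      _ = _ := by rw [this]
  calc Torus.eContDiffHolderNorm 1 (Real.toNNReal α) (vℓ t) * Torus.eContDiffHolderNorm N (Real.toNNReal α) (BDSV.biotSavart (velDiff v i t)) +
        Torus.eContDiffHolderNorm (N + 1) (Real.toNNReal α) (vℓ t) * Torus.eContDiffHolderNorm 0 (Real.toNNReal α) (BDSV.biotSavart (velDiff v i t))
      ≤ ENNReal.ofReal (V₀ * (Aq * ℓ ^ (-((0 : ℕ) : ℝ) - α))) * ENNReal.ofReal (|C₃| * (τ * δ * ℓ ^ (-(N : ℝ) + α))) +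
          ENNReal.ofReal (V₁ * (Aq * ℓ ^ (-(N : ℝ) - α))) * ENNReal.ofReal (|C₃| * (τ * δ * ℓ ^ (-((0 : ℕ) : ℝ) + α))) :=
        add_le_add (mul_le_mul' hb1 hz1) (mul_le_mul' hb2 hz2)
    _ = ENNReal.ofReal (V₀ * |C₃| * δ * (τ * Aq * ℓ ^ (-(N : ℝ)))) + ENNReal.ofReal (V₁ * |C₃| * δ * (τ * Aq * ℓ ^ (-(N : ℝ)))) := by
        rw [← ENNReal.ofReal_mul (by positivity), ← ENNReal.ofReal_mul (by positivity), e1, e2]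
    _ ≤ ENNReal.ofReal (V₀ * |C₃| * δ * ℓ ^ (-(N : ℝ) + α)) + ENNReal.ofReal (V₁ * |C₃| * δ * ℓ ^ (-(N : ℝ) + α)) := by
        gcongr
    _ = ENNReal.ofReal ((V₀ + V₁) * |C₃| * (δ * ℓ ^ (-(N : ℝ) + α))) := by
        rw [← ENNReal.ofReal_add (by positivity) (by positivity)]; ring_nf

/-- **The transported transition term** `D_{t,ℓ}(wᵢ ⊗̊ wᵢ) = B(D_{t,ℓ}wᵢ, wᵢ) + B(wᵢ, D_{t,ℓ}wᵢ)` at a time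
of `[tᵢ, tᵢ + τ]` (`i < n`): `‖·‖_{N+α} ≤ 2·3ᴺ‖B‖(N+1) 4C₃² τ_q δ_{q+1}² ℓ^{-N-2+2α}` (BDSV:
"`‖D_{t,ℓ}(vᵢ-vᵢ₊₁)‖_{N+α}‖vᵢ-vᵢ₊₁‖_α + ‖vᵢ-vᵢ₊₁‖_{N+α}‖D_{t,ℓ}(vᵢ-vᵢ₊₁)‖_α`"). [cite: Derosa2018, §5.2 Prop. 5.5 (5.17)] -/
theorem IsGlueFamily.eContDiffHolderNorm_transition_transport_le
    (h : IsGlueFamily γ ν T (glueScale β α a b q) n vℓ pℓ Rℓ v p)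
    (hS : ∀ i : ℕ, i ≤ n → StabilityBounds β α a b T C₃ q Nb i vℓ pℓ (v i) (p i)) (ha : 1 ≤ a)
    {N : ℕ} (hN : N ≤ Nb)
    {i : ℕ} (hi : i < n) {t : ℝ} (ht : t ∈ Icc ((i : ℝ) * glueScale β α a b q) ((i : ℝ) * glueScale β α a b q + glueScale β α a b q))
    (htT : t ∈ Icc 0 T) :
    Torus.eContDiffHolderNorm N (Real.toNNReal α)
        (fun x => B (advectiveDerivWithin (Icc ((i : ℝ) * glueScale β α a b q) ((i : ℝ) * glueScale β α a b q + glueScale β α a b q)) vℓ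
            (velDiff v i) t x) (velDiff v i t x) +
          B (velDiff v i t x) (advectiveDerivWithin (Icc ((i : ℝ) * glueScale β α a b q) ((i : ℝ) * glueScale β α a b q + glueScale β α a b q)) vℓ
            (velDiff v i) t x)) ≤
      2 * (3 ^ N * ‖B‖ₑ * ((N + 1 : ℕ) * ENNReal.ofReal (4 * C₃ ^ 2 *
        (glueScale β α a b q * amp β a b (q + 1) ^ 2 * mollScale β α a b q ^ (-(N : ℝ) - 2 + 2 * α))))) := by
  set τ := glueScale β α a b q with hτdef
  set δ := amp β a b (q + 1) with hδdef
  set ℓ := mollScale β α a b q with hℓdef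
  have hτ : 0 < τ := h.hτ
  have hδ : 0 < δ := amp_pos ha (q + 1)
  have hℓ : 0 < ℓ := mollScale_pos ha q
  set S : Set ℝ := Icc ((i : ℝ) * τ) ((i : ℝ) * τ + τ) with hSdef
  have hlt : (i : ℝ) * τ < (i : ℝ) * τ + τ := by linarith
  have hSU : UniqueDiffOn ℝ S := uniqueDiffOn_Icc hlt
  have hwS : FunctionSpaces.Torus.IsSmoothSpaceTimeOn S (velDiff v i) := h.smooth_velDiff hi
  have hwt : IsSmooth (velDiff v i t) := hwS.isSmooth_slice ht
  have hvℓt : IsSmooth (vℓ t) := h.isSmooth_vℓ htT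
  set Dw : UnitAddTorus (Fin 3) → EuclideanSpace ℝ (Fin 3) := advectiveDerivWithin S vℓ (velDiff v i) t with hDw
  have hDws : IsSmooth Dw := ((hwS.timeDerivWithin hSU).isSmooth_slice ht).add (hvℓt.convect hwt)
  have hDwN : IsContDiff N Dw := hDws.isContDiff (mod_cast le_top)
  have hwN : IsContDiff N (velDiff v i t) := hwt.isContDiff (mod_cast le_top)
  have hDwj : ∀ j : ℕ, j ≤ N → Torus.eContDiffHolderNorm j (Real.toNNReal α) Dw ≤
      ENNReal.ofReal (2 * |C₃| * (δ * ℓ ^ (-(j : ℝ) - 1 + α))) :=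
    fun j hj => h.eContDiffHolderNorm_transport_velDiff_le hS ha hi ht (hj.trans hN)
  have hwj : ∀ j : ℕ, j ≤ N → Torus.eContDiffHolderNorm j (Real.toNNReal α) (velDiff v i t) ≤
      ENNReal.ofReal (2 * |C₃| * (τ * δ * ℓ ^ (-(j : ℝ) - 1 + α))) :=
    fun j hj => h.eContDiffHolderNorm_velDiff_le hS ha hi ht (hj.trans hN)
  have hexp : ∀ j : ℕ, j ≤ N → ℓ ^ (-(j : ℝ) - 1 + α) * ℓ ^ (-((N - j : ℕ) : ℝ) - 1 + α) = ℓ ^ (-(N : ℝ) - 2 + 2 * α) := by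
    intro j hj
    rw [← Real.rpow_add hℓ, Nat.cast_sub hj]; congr 1; ring
  have hterm : ∀ j ∈ Finset.range (N + 1),
      Torus.eContDiffHolderNorm j (Real.toNNReal α) Dw * Torus.eContDiffHolderNorm (N - j) (Real.toNNReal α) (velDiff v i t) ≤
        ENNReal.ofReal (4 * C₃ ^ 2 * (τ * δ ^ 2 * ℓ ^ (-(N : ℝ) - 2 + 2 * α))) ∧
      Torus.eContDiffHolderNorm j (Real.toNNReal α) (velDiff v i t) * Torus.eContDiffHolderNorm (N - j) (Real.toNNReal α) Dw ≤
        ENNReal.ofReal (4 * C₃ ^ 2 * (τ * δ ^ 2 * ℓ ^ (-(N : ℝ) - 2 + 2 * α))) := by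
    intro j hj
    have hjN : j ≤ N := Nat.lt_succ_iff.1 (Finset.mem_range.1 hj)
    have hNj : N - j ≤ N := Nat.sub_le N j
    have hexp' := hexp j hjN
    constructor
    · refine (mul_le_mul' (hDwj j hjN) (hwj (N - j) hNj)).trans ?_
      rw [← ENNReal.ofReal_mul (by positivity)]
      refine ENNReal.ofReal_le_ofReal (le_of_eq ?_)
      calc 2 * |C₃| * (δ * ℓ ^ (-(j : ℝ) - 1 + α)) * (2 * |C₃| * (τ * δ * ℓ ^ (-((N - j : ℕ) : ℝ) - 1 + α)))
          = 4 * (|C₃| * |C₃|) * (τ * δ ^ 2 * (ℓ ^ (-(j : ℝ) - 1 + α) * ℓ ^ (-((N - j : ℕ) : ℝ) - 1 + α))) := by ring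
        _ = _ := by rw [hexp', ← sq, sq_abs]
    · refine (mul_le_mul' (hwj j hjN) (hDwj (N - j) hNj)).trans ?_
      rw [← ENNReal.ofReal_mul (by positivity)]
      refine ENNReal.ofReal_le_ofReal (le_of_eq ?_)
      calc 2 * |C₃| * (τ * δ * ℓ ^ (-(j : ℝ) - 1 + α)) * (2 * |C₃| * (δ * ℓ ^ (-((N - j : ℕ) : ℝ) - 1 + α)))
          = 4 * (|C₃| * |C₃|) * (τ * δ ^ 2 * (ℓ ^ (-(j : ℝ) - 1 + α) * ℓ ^ (-((N - j : ℕ) : ℝ) - 1 + α))) := by ring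
        _ = _ := by rw [hexp', ← sq, sq_abs]
  have hsum1 : ∑ j ∈ Finset.range (N + 1), Torus.eContDiffHolderNorm j (Real.toNNReal α) Dw *
      Torus.eContDiffHolderNorm (N - j) (Real.toNNReal α) (velDiff v i t) ≤
        (N + 1 : ℕ) * ENNReal.ofReal (4 * C₃ ^ 2 * (τ * δ ^ 2 * ℓ ^ (-(N : ℝ) - 2 + 2 * α))) := by
    calc ∑ j ∈ Finset.range (N + 1), Torus.eContDiffHolderNorm j (Real.toNNReal α) Dw * Torus.eContDiffHolderNorm (N - j) (Real.toNNReal α) (velDiff v i t)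
        ≤ ∑ _j ∈ Finset.range (N + 1), ENNReal.ofReal (4 * C₃ ^ 2 * (τ * δ ^ 2 * ℓ ^ (-(N : ℝ) - 2 + 2 * α))) :=
          Finset.sum_le_sum fun j hj => (hterm j hj).1
      _ = _ := by rw [Finset.sum_const, Finset.card_range, nsmul_eq_mul]
  have hsum2 : ∑ j ∈ Finset.range (N + 1), Torus.eContDiffHolderNorm j (Real.toNNReal α) (velDiff v i t) *
      Torus.eContDiffHolderNorm (N - j) (Real.toNNReal α) Dw ≤
        (N + 1 : ℕ) * ENNReal.ofReal (4 * C₃ ^ 2 * (τ * δ ^ 2 * ℓ ^ (-(N : ℝ) - 2 + 2 * α))) := by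
    calc ∑ j ∈ Finset.range (N + 1), Torus.eContDiffHolderNorm j (Real.toNNReal α) (velDiff v i t) * Torus.eContDiffHolderNorm (N - j) (Real.toNNReal α) Dw
        ≤ ∑ _j ∈ Finset.range (N + 1), ENNReal.ofReal (4 * C₃ ^ 2 * (τ * δ ^ 2 * ℓ ^ (-(N : ℝ) - 2 + 2 * α))) :=
          Finset.sum_le_sum fun j hj => (hterm j hj).2
      _ = _ := by rw [Finset.sum_const, Finset.card_range, nsmul_eq_mul]
  have hB1 := Torus.eContDiffHolderNorm_bilinear_le B hDwN hwN (Real.toNNReal α)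
  have hB2 := Torus.eContDiffHolderNorm_bilinear_le B hwN hDwN (Real.toNNReal α)
  have hs1 : IsContDiff N (fun x => B (Dw x) (velDiff v i t x)) := (IsSmooth.bilinear B hDws hwt).isContDiff (mod_cast le_top)
  have hs2 : IsContDiff N (fun x => B (velDiff v i t x) (Dw x)) := (IsSmooth.bilinear B hwt hDws).isContDiff (mod_cast le_top)
  calc Torus.eContDiffHolderNorm N (Real.toNNReal α) (fun x => B (Dw x) (velDiff v i t x) + B (velDiff v i t x) (Dw x))
      ≤ Torus.eContDiffHolderNorm N (Real.toNNReal α) (fun x => B (Dw x) (velDiff v i t x)) +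
          Torus.eContDiffHolderNorm N (Real.toNNReal α) (fun x => B (velDiff v i t x) (Dw x)) := Torus.eContDiffHolderNorm_add_le hs1 hs2
    _ ≤ 3 ^ N * ‖B‖ₑ * ((N + 1 : ℕ) * ENNReal.ofReal (4 * C₃ ^ 2 * (τ * δ ^ 2 * ℓ ^ (-(N : ℝ) - 2 + 2 * α)))) +
          3 ^ N * ‖B‖ₑ * ((N + 1 : ℕ) * ENNReal.ofReal (4 * C₃ ^ 2 * (τ * δ ^ 2 * ℓ ^ (-(N : ℝ) - 2 + 2 * α)))) :=
        add_le_add (hB1.trans (mul_le_mul' le_rfl hsum1)) (hB2.trans (mul_le_mul' le_rfl hsum2))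
    _ = _ := by rw [← two_mul]

/-- **The relative transport term** `((v̄_q - v_ℓ)·∇)R̊̄_q` at a time of `[0,T]`:
`‖·‖_{N+α} ≤ 3ᴺ(N+1)|C₃| K' τ_q δ_{q+1}² ℓ^{-N-2+2α}` with `K'` the constant of (2.20) at order `N+1`
(BDSV: "`‖(v_ℓ-v̄_q)·∇R̊̄_q‖_{N+α} ≲ ‖v_ℓ-v̄_q‖_{N+α}‖R̊̄_q‖_{1+α} + ‖v_ℓ-v̄_q‖_α‖R̊̄_q‖_{N+1+α} ≲ τ_qδ_{q+1}²ℓ^{-N-2+2α}`").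
[cite: Derosa2018, §5.2 Prop. 5.5 (5.17)] -/
theorem IsGlueFamily.eContDiffHolderNorm_convect_gluedStress_le
    (hB : ∀ (a b : EuclideanSpace ℝ (Fin 3)) (j : Fin 3), B a b j = a j • b - (inner ℝ a b / 3) • EuclideanSpace.single j (1 : ℝ))
    (h : IsGlueFamily γ ν T (glueScale β α a b q) n vℓ pℓ Rℓ v p)
    (hS : ∀ i : ℕ, i ≤ n → StabilityBounds β α a b T C₃ q Nb i vℓ pℓ (v i) (p i))
    (hP : ∀ i : ℕ, i < n → PotentialBounds β α a b T C₃ q Nb i vℓ (v i) (v (i + 1)))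
    (ha : 1 ≤ a) (hb : 1 ≤ b) (hβ : 0 ≤ β) (hα : 0 ≤ α) {N : ℕ} (hN : N + 1 ≤ Nb) {Ccz : ℝ≥0∞}
    (hcz : ∀ m : ℕ, m ≤ N + 1 → ∀ z : UnitAddTorus (Fin 3) → EuclideanSpace ℝ (Fin 3), IsSmooth z →
      Torus.eContDiffHolderNorm m (Real.toNNReal α) (fun x => Torus.antidivergence (BDSV.curl z) x) ≤
        Ccz * Torus.eContDiffHolderNorm m (Real.toNNReal α) z)
    {t : ℝ} (htT : t ∈ Icc 0 T) :
    Torus.eContDiffHolderNorm N (Real.toNNReal α)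
        (fun x => FunctionSpaces.Torus.convect (fun y => gluedVel (glueScale β α a b q) n v t y - vℓ t y)
          (gluedStress (glueScale β α a b q) n v t) x) ≤
      3 ^ N * ((N + 1 : ℕ) * ENNReal.ofReal |C₃|) *
        (ENNReal.ofReal (stepProfileBound 1 * |C₃|) * Ccz + 3 ^ (N + 1) * ‖B‖ₑ * ((N + 1 + 1 : ℕ) * ENNReal.ofReal (4 * C₃ ^ 2))) *
        ENNReal.ofReal (glueScale β α a b q * amp β a b (q + 1) ^ 2 * mollScale β α a b q ^ (-(N : ℝ) - 2 + 2 * α)) := by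
  set τ := glueScale β α a b q with hτdef
  set δ := amp β a b (q + 1) with hδdef
  set ℓ := mollScale β α a b q with hℓdef
  have hτ : 0 < τ := h.hτ
  have hδ : 0 < δ := amp_pos ha (q + 1)
  have hℓ : 0 < ℓ := mollScale_pos ha q
  set K' : ℝ≥0∞ := ENNReal.ofReal (stepProfileBound 1 * |C₃|) * Ccz +
    3 ^ (N + 1) * ‖B‖ₑ * ((N + 1 + 1 : ℕ) * ENNReal.ofReal (4 * C₃ ^ 2)) with hK'
  have hvℓt : IsSmooth (vℓ t) := h.isSmooth_vℓ htT
  have hRt : IsSmooth (gluedStress τ n v t) := h.smooth_gluedStress.isSmooth_slice htT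
  have hut : IsSmooth (fun y => gluedVel τ n v t y - vℓ t y) := (h.smooth_gluedVel.isSmooth_slice htT).sub hvℓt
  have huN : IsContDiff N (fun y => gluedVel τ n v t y - vℓ t y) := hut.isContDiff (mod_cast le_top)
  have hRN : IsContDiff (N + 1 : ℕ) (gluedStress τ n v t) := hRt.isContDiff (mod_cast le_top)
  have hconv := Torus.eContDiffHolderNorm_convect_le huN hRN (Real.toNNReal α)
  have huj : ∀ j : ℕ, j ≤ N → Torus.eContDiffHolderNorm j (Real.toNNReal α) (fun y => gluedVel τ n v t y - vℓ t y) ≤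
      ENNReal.ofReal (|C₃| * (τ * δ * ℓ ^ (-(j : ℝ) - 1 + α))) :=
    fun j hj => h.holderSupLE_gluedVel_sub hS ha (hj.trans ((Nat.le_succ N).trans hN)) t htT
  have hRm : ∀ m : ℕ, m ≤ N + 1 → Torus.eContDiffHolderNorm m (Real.toNNReal α) (gluedStress τ n v t) ≤
      K' * ENNReal.ofReal (δ * ℓ ^ (-(m : ℝ) + α)) := by
    intro m hm
    refine (h.eContDiffHolderNorm_gluedStress_le hB hS hP ha hb hβ hα (hm.trans hN) (hcz m hm) htT).trans ?_
    exact mul_le_mul' (stressSizeConst_mono B C₃ Ccz hm) le_rfl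
  have hterm : ∀ j ∈ Finset.range (N + 1),
      Torus.eContDiffHolderNorm j (Real.toNNReal α) (fun y => gluedVel τ n v t y - vℓ t y) *
          Torus.eContDiffHolderNorm (N - j + 1) (Real.toNNReal α) (gluedStress τ n v t) ≤
        ENNReal.ofReal |C₃| * K' * ENNReal.ofReal (τ * δ ^ 2 * ℓ ^ (-(N : ℝ) - 2 + 2 * α)) := by
    intro j hj
    have hjN : j ≤ N := Nat.lt_succ_iff.1 (Finset.mem_range.1 hj)
    have hm : N - j + 1 ≤ N + 1 := Nat.succ_le_succ (Nat.sub_le N j)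
    refine (mul_le_mul' (huj j hjN) (hRm (N - j + 1) hm)).trans (le_of_eq ?_)
    have hexp : ℓ ^ (-(j : ℝ) - 1 + α) * ℓ ^ (-((N - j + 1 : ℕ) : ℝ) + α) = ℓ ^ (-(N : ℝ) - 2 + 2 * α) := by
      rw [← Real.rpow_add hℓ]; congr 1; push_cast; rw [Nat.cast_sub hjN]; ring
    have ereal : |C₃| * (τ * δ * ℓ ^ (-(j : ℝ) - 1 + α)) * (δ * ℓ ^ (-((N - j + 1 : ℕ) : ℝ) + α)) =
        |C₃| * (τ * δ ^ 2 * ℓ ^ (-(N : ℝ) - 2 + 2 * α)) := by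
      calc |C₃| * (τ * δ * ℓ ^ (-(j : ℝ) - 1 + α)) * (δ * ℓ ^ (-((N - j + 1 : ℕ) : ℝ) + α))
          = |C₃| * (τ * δ ^ 2 * (ℓ ^ (-(j : ℝ) - 1 + α) * ℓ ^ (-((N - j + 1 : ℕ) : ℝ) + α))) := by ring
        _ = _ := by rw [hexp]
    have step : ENNReal.ofReal (|C₃| * (τ * δ * ℓ ^ (-(j : ℝ) - 1 + α))) * ENNReal.ofReal (δ * ℓ ^ (-((N - j + 1 : ℕ) : ℝ) + α)) =
        ENNReal.ofReal |C₃| * ENNReal.ofReal (τ * δ ^ 2 * ℓ ^ (-(N : ℝ) - 2 + 2 * α)) := by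
      rw [← ENNReal.ofReal_mul (by positivity), ereal, ENNReal.ofReal_mul (abs_nonneg _)]
    calc ENNReal.ofReal (|C₃| * (τ * δ * ℓ ^ (-(j : ℝ) - 1 + α))) * (K' * ENNReal.ofReal (δ * ℓ ^ (-((N - j + 1 : ℕ) : ℝ) + α)))
        = K' * (ENNReal.ofReal (|C₃| * (τ * δ * ℓ ^ (-(j : ℝ) - 1 + α))) * ENNReal.ofReal (δ * ℓ ^ (-((N - j + 1 : ℕ) : ℝ) + α))) := by
          rw [mul_left_comm, mul_assoc]
      _ = K' * (ENNReal.ofReal |C₃| * ENNReal.ofReal (τ * δ ^ 2 * ℓ ^ (-(N : ℝ) - 2 + 2 * α))) := by rw [step]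
      _ = ENNReal.ofReal |C₃| * K' * ENNReal.ofReal (τ * δ ^ 2 * ℓ ^ (-(N : ℝ) - 2 + 2 * α)) := by
          rw [← mul_assoc, mul_comm K']
  calc Torus.eContDiffHolderNorm N (Real.toNNReal α) (fun x => FunctionSpaces.Torus.convect (fun y => gluedVel τ n v t y - vℓ t y) (gluedStress τ n v t) x)
      ≤ 3 ^ N * ∑ j ∈ Finset.range (N + 1),
          Torus.eContDiffHolderNorm j (Real.toNNReal α) (fun y => gluedVel τ n v t y - vℓ t y) *
            Torus.eContDiffHolderNorm (N - j + 1) (Real.toNNReal α) (gluedStress τ n v t) := hconv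
    _ ≤ 3 ^ N * ∑ _j ∈ Finset.range (N + 1), ENNReal.ofReal |C₃| * K' * ENNReal.ofReal (τ * δ ^ 2 * ℓ ^ (-(N : ℝ) - 2 + 2 * α)) :=
        mul_le_mul' le_rfl (Finset.sum_le_sum hterm)
    _ = _ := by
        rw [Finset.sum_const, Finset.card_range, nsmul_eq_mul]
        ring

set_option maxHeartbeats 800000 in
/-- **Prop. 4.3, (4.8) = (2.21), at a fixed time**: for `t ∈ [0,T]` and `N + 1 ≤ N̄`,
`‖(∂ₜ + v̄_q·∇)R̊̄_q(t)‖_{N+α} ≤ K δ_{q+1} δ_q^{1/2} λ_q ℓ^{-N-α}` with an explicit constant `K`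
depending on `N`, `C₃`, the constants `C_in` of (2.13), a Calderón–Zygmund constant `C_cz` for
`ℛ ∘ curl` at the orders `≤ N + 1` (App. C), a commutator constant `C_cm` for `[b·∇, ℛ curl]` at
order `N` (App. D, Prop. D.1) and the cut-off constants `E₁, E₂` (4.3). This is BDSV's computation
"`‖D_{t,ℓ}R̊̄_q‖_{N+α} ≲ τ_q⁻²‖zᵢ-zᵢ₊₁‖_{N+α} + τ_q⁻¹‖D_{t,ℓ}(zᵢ-zᵢ₊₁)‖_{N+α} + τ_q⁻¹‖v_ℓ‖_{1+α}‖zᵢ-zᵢ₊₁‖_{N+α} +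
τ_q⁻¹‖v_ℓ‖_{N+1+α}‖zᵢ-zᵢ₊₁‖_α + τ_q⁻¹‖vᵢ-vᵢ₊₁‖_{N+α}‖vᵢ-vᵢ₊₁‖_α + ‖D_{t,ℓ}(vᵢ-vᵢ₊₁)‖_{N+α}‖vᵢ-vᵢ₊₁‖_α +
‖vᵢ-vᵢ₊₁‖_{N+α}‖D_{t,ℓ}(vᵢ-vᵢ₊₁)‖_α ≲ τ_q⁻¹δ_{q+1}ℓ^{-N+α}`" followed by
"`‖(∂ₜ + v̄_q·∇)R̊̄_q‖_{N+α} ≲ ‖v_ℓ-v̄_q‖_{N+α}‖R̊̄_q‖_{1+α} + ‖v_ℓ-v̄_q‖_α‖R̊̄_q‖_{N+1+α} + ‖D_{t,ℓ}R̊̄_q‖_{N+α} ≲ τ_q⁻¹δ_{q+1}ℓ^{-N+α} = δ_{q+1}^{1/2}δ_q^{1/2}λ_qℓ^{-N-α}`"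
(the last equality printed with the misprint `δ_{q+1}^{1/2}` for `δ_{q+1}`, cf. (2.21)).
[cite: Derosa2018, §5.2 Prop. 5.5 (5.17)] -/
theorem IsGlueFamily.eContDiffHolderNorm_advectiveDeriv_gluedStress_le
    (hB : ∀ (a b : EuclideanSpace ℝ (Fin 3)) (j : Fin 3), B a b j = a j • b - (inner ℝ a b / 3) • EuclideanSpace.single j (1 : ℝ))
    (h : IsGlueFamily γ ν T (glueScale β α a b q) n vℓ pℓ Rℓ v p)
    (hS : ∀ i : ℕ, i ≤ n → StabilityBounds β α a b T C₃ q Nb i vℓ pℓ (v i) (p i))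
    (hP : ∀ i : ℕ, i < n → PotentialBounds β α a b T C₃ q Nb i vℓ (v i) (v (i + 1)))
    (ha : 1 ≤ a) (hb : 1 ≤ b) (hβ : 0 ≤ β) (hα : 0 < α) (hα1 : α < 1)
    (h213 : ∀ N : ℕ, HolderSupLE T vℓ (N + 1) 0
      (Cin N * (Real.sqrt (amp β a b q) * freq a b q * mollScale β α a b q ^ (-(N : ℝ)))))
    {N : ℕ} (hN : N + 1 ≤ Nb) {Ccz Ccm : ℝ≥0∞}
    (hcz : ∀ m : ℕ, m ≤ N + 1 → ∀ z : UnitAddTorus (Fin 3) → EuclideanSpace ℝ (Fin 3), IsSmooth z →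
      Torus.eContDiffHolderNorm m (Real.toNNReal α) (fun x => Torus.antidivergence (BDSV.curl z) x) ≤
        Ccz * Torus.eContDiffHolderNorm m (Real.toNNReal α) z)
    (hcm : ∀ bb z : UnitAddTorus (Fin 3) → EuclideanSpace ℝ (Fin 3), IsSmooth bb → IsSmooth z →
      Torus.eContDiffHolderNorm N (Real.toNNReal α)
          (fun x => FunctionSpaces.Torus.convect bb (fun y => Torus.antidivergence (BDSV.curl z) y) x -
            Torus.antidivergence (BDSV.curl (FunctionSpaces.Torus.convect bb z)) x) ≤
        Ccm * (Torus.eContDiffHolderNorm 1 (Real.toNNReal α) bb * Torus.eContDiffHolderNorm N (Real.toNNReal α) z +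
          Torus.eContDiffHolderNorm (N + 1) (Real.toNNReal α) bb * Torus.eContDiffHolderNorm 0 (Real.toNNReal α) z))
    {t : ℝ} (htT : t ∈ Icc 0 T) :
    Torus.eContDiffHolderNorm N (Real.toNNReal α)
        (advectiveDeriv T (gluedVel (glueScale β α a b q) n v) (gluedStress (glueScale β α a b q) n v) t) ≤
      (Ccz * ENNReal.ofReal ((stepProfileBound 2 + stepProfileBound 1) * |C₃|) +
        Ccm * ENNReal.ofReal (stepProfileBound 1 *
          ((((0 : ℕ) : ℝ) + 4) * |Cin 0| + |Cin (0 + 1)| + ((((N : ℕ) : ℝ) + 4) * |Cin N| + |Cin (N + 1)|)) * |C₃|) +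
        3 ^ N * ‖B‖ₑ * ((N + 1 : ℕ) * ENNReal.ofReal (8 * (stepProfileBound 1 + 1) * C₃ ^ 2)) +
        3 ^ N * ((N + 1 : ℕ) * ENNReal.ofReal |C₃|) *
          (ENNReal.ofReal (stepProfileBound 1 * |C₃|) * Ccz + 3 ^ (N + 1) * ‖B‖ₑ * ((N + 1 + 1 : ℕ) * ENNReal.ofReal (4 * C₃ ^ 2)))) *
        ENNReal.ofReal (amp β a b (q + 1) * Real.sqrt (amp β a b q) * freq a b q * mollScale β α a b q ^ (-(N : ℝ) - α)) := by
  -- parameters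
  set τ := glueScale β α a b q with hτdef
  set δ := amp β a b (q + 1) with hδdef
  set ℓ := mollScale β α a b q with hℓdef
  set Aq := Real.sqrt (amp β a b q) * freq a b q with hAqdef
  have hτ : 0 < τ := h.hτ
  have hδ : 0 < δ := amp_pos ha (q + 1)
  have hℓ : 0 < ℓ := mollScale_pos ha q
  have hℓ1 : ℓ ≤ 1 := mollScale_le_one ha hb hβ hα.le q
  have hAq : 0 < Aq := mul_pos (Real.sqrt_pos.2 (amp_pos ha q)) (freq_pos ha q)
  set E₁ := stepProfileBound 1 with hE₁
  set E₂ := stepProfileBound 2 with hE₂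
  have hE₁0 : 0 ≤ E₁ := stepProfileBound_nonneg 1
  have hE₂0 : 0 ≤ E₂ := stepProfileBound_nonneg 2
  -- the target scale `X = τ⁻¹ δ ℓ^{-N+α} = δ δ_q^{1/2} λ_q ℓ^{-N-α}`
  set X := τ⁻¹ * (δ * ℓ ^ (-(N : ℝ) + α)) with hXdef
  have hX0 : 0 ≤ X := by positivity
  have hXeq : X = δ * Real.sqrt (amp β a b q) * freq a b q * ℓ ^ (-(N : ℝ) - α) := glueScale_inv_mul_eq ha q N
  rw [← hXeq]
  -- the constants
  set K' : ℝ≥0∞ := ENNReal.ofReal (E₁ * |C₃|) * Ccz + 3 ^ (N + 1) * ‖B‖ₑ * ((N + 1 + 1 : ℕ) * ENNReal.ofReal (4 * C₃ ^ 2)) with hK'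
  set V₀ : ℝ := (((0 : ℕ) : ℝ) + 4) * |Cin 0| + |Cin (0 + 1)| with hV₀
  set V₁ : ℝ := (((N : ℕ) : ℝ) + 4) * |Cin N| + |Cin (N + 1)| with hV₁
  have hV₀0 : 0 ≤ V₀ := by positivity
  have hV₁0 : 0 ≤ V₁ := by positivity
  -- localisation in time
  obtain ⟨i, hin, hti⟩ := h.exists_anchor htT
  have hsm : ∀ s ∈ Icc 0 T, IsSmooth (vℓ s) := fun s hs => h.isSmooth_vℓ hs
  rcases lt_or_eq_of_le hin with hi | rfl
  swap
  · -- `i = n`: the stress vanishes identically near `t`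
    have e : advectiveDeriv T (gluedVel τ i v) (gluedStress τ i v) t = fun _ => 0 := by
      funext x
      rw [h.advectiveDeriv_gluedStress hti htT (gluedVel τ i v) x, if_neg (lt_irrefl _)]
    rw [e, show (fun _ : UnitAddTorus (Fin 3) => (0 : Fin 3 → EuclideanSpace ℝ (Fin 3))) = 0 from rfl,
      Torus.eContDiffHolderNorm_zero_fun]
    exact bot_le
  -- `i < n`: notation
  set S : Set ℝ := Icc ((i : ℝ) * τ) ((i : ℝ) * τ + τ) with hSdef
  have hlt : (i : ℝ) * τ < (i : ℝ) * τ + τ := by linarith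
  have hSU : UniqueDiffOn ℝ S := uniqueDiffOn_Icc hlt
  set w : ℝ → UnitAddTorus (Fin 3) → EuclideanSpace ℝ (Fin 3) := velDiff v i with hwdef
  set z : ℝ → UnitAddTorus (Fin 3) → EuclideanSpace ℝ (Fin 3) := fun s x => BDSV.biotSavart (fun y => v i s y - v (i + 1) s y) x with hzdef
  have hwS : FunctionSpaces.Torus.IsSmoothSpaceTimeOn S w := h.smooth_velDiff hi
  have hzS : FunctionSpaces.Torus.IsSmoothSpaceTimeOn S z := h.smooth_biotSavart_velDiff hi
  have hwz : ∀ s ∈ S, w s = BDSV.curl (z s) := fun s hs => (h.curl_biotSavart_velDiff hi hs).symm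
  have hwt : IsSmooth (w t) := hwS.isSmooth_slice hti
  have hzt : IsSmooth (z t) := hzS.isSmooth_slice hti
  have hvℓt : IsSmooth (vℓ t) := hsm t htT
  -- the transport derivatives along `v_ℓ` within `S`
  set Dz : UnitAddTorus (Fin 3) → EuclideanSpace ℝ (Fin 3) := advectiveDerivWithin S vℓ z t with hDz
  set Dw : UnitAddTorus (Fin 3) → EuclideanSpace ℝ (Fin 3) := advectiveDerivWithin S vℓ w t with hDw
  have hDzs : IsSmooth Dz := ((hzS.timeDerivWithin hSU).isSmooth_slice hti).add (hvℓt.convect hzt)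
  have hDws : IsSmooth Dw := ((hwS.timeDerivWithin hSU).isSmooth_slice hti).add (hvℓt.convect hwt)
  -- the six fields
  set g₁ : UnitAddTorus (Fin 3) → Fin 3 → EuclideanSpace ℝ (Fin 3) := fun x => Torus.antidivergence (w t) x with hg₁
  set g₂ : UnitAddTorus (Fin 3) → Fin 3 → EuclideanSpace ℝ (Fin 3) := fun x => Torus.antidivergence (BDSV.curl Dz) x with hg₂
  set g₃ : UnitAddTorus (Fin 3) → Fin 3 → EuclideanSpace ℝ (Fin 3) := fun x =>
    FunctionSpaces.Torus.convect (vℓ t) (fun y => Torus.antidivergence (BDSV.curl (z t)) y) x -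
      Torus.antidivergence (BDSV.curl (FunctionSpaces.Torus.convect (vℓ t) (z t))) x with hg₃
  set g₄ : UnitAddTorus (Fin 3) → Fin 3 → EuclideanSpace ℝ (Fin 3) := Torus.tracelessSq (w t) with hg₄
  set g₅ : UnitAddTorus (Fin 3) → Fin 3 → EuclideanSpace ℝ (Fin 3) := fun x => B (Dw x) (w t x) + B (w t x) (Dw x) with hg₅
  set g₆ : UnitAddTorus (Fin 3) → Fin 3 → EuclideanSpace ℝ (Fin 3) := fun x =>
    FunctionSpaces.Torus.convect (fun y => gluedVel τ n v t y - vℓ t y) (gluedStress τ n v t) x with hg₆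
  have hg₁s : IsSmooth g₁ := Torus.isSmooth_antidivergence hwt
  have hg₂s : IsSmooth g₂ := Torus.isSmooth_antidivergence (isSmooth_curl hDzs)
  have hg₃s : IsSmooth g₃ := (hvℓt.convect (Torus.isSmooth_antidivergence (isSmooth_curl hzt))).sub
    (Torus.isSmooth_antidivergence (isSmooth_curl (hvℓt.convect hzt)))
  have hg₄s : IsSmooth g₄ := hwt.tracelessSq
  have hg₅s : IsSmooth g₅ := (IsSmooth.bilinear B hDws hwt).add (IsSmooth.bilinear B hwt hDws)
  have hRt : IsSmooth (gluedStress τ n v t) := h.smooth_gluedStress.isSmooth_slice htT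
  have hut : IsSmooth (fun y => gluedVel τ n v t y - vℓ t y) := (h.smooth_gluedVel.isSmooth_slice htT).sub hvℓt
  have hg₆s : IsSmooth g₆ := hut.convect hRt
  -- the scalar factors
  set θ'' := deriv (stepDeriv τ n i) t with hθ''
  set θ' := stepDeriv τ n i t with hθ'
  set ww' := deriv (stepWeight τ n i) t with hww'
  set ww := stepWeight τ n i t with hww
  -- **the formula for `(∂ₜ + v̄·∇)R̊̄(t)`**
  have hF : advectiveDeriv T (gluedVel τ n v) (gluedStress τ n v) t =
      θ'' • g₁ + θ' • g₂ + θ' • g₃ - (ww' • g₄ + ww • g₅) + g₆ := by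
    funext x
    -- split `v̄ = v_ℓ + (v̄ - v_ℓ)`
    have hsplit : advectiveDeriv T (gluedVel τ n v) (gluedStress τ n v) t x =
        advectiveDeriv T vℓ (gluedStress τ n v) t x + g₆ x := by
      show FunctionSpaces.Torus.timeDerivWithin (Icc 0 T) (gluedStress τ n v) t x +
          FunctionSpaces.Torus.convect (gluedVel τ n v t) (gluedStress τ n v t) x =
        FunctionSpaces.Torus.timeDerivWithin (Icc 0 T) (gluedStress τ n v) t x +
          FunctionSpaces.Torus.convect (vℓ t) (gluedStress τ n v t) x +
          FunctionSpaces.Torus.convect (fun y => gluedVel τ n v t y - vℓ t y) (gluedStress τ n v t) x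
      rw [show (fun y => gluedVel τ n v t y - vℓ t y) = gluedVel τ n v t - vℓ t from rfl, convect_sub_left]
      abel
    have hA : advectiveDerivWithin S vℓ (fun s => Torus.antidivergence (velDiff v i s)) t x = g₂ x + g₃ x :=
      advectiveDerivWithin_antidivergence_eq hlt hzS hwz hti hvℓt x
    have hQ : advectiveDerivWithin S vℓ (fun s => Torus.tracelessSq (velDiff v i s)) t x = B (Dw x) (w t x) + B (w t x) (Dw x) := by
      rw [show (fun s => Torus.tracelessSq (velDiff v i s)) = fun s y => B (w s y) (w s y) from
        funext fun s => tracelessSq_eq_bilinear_fun hB _]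
      exact advectiveDerivWithin_bilinear hlt B hwS hwS hti x
    rw [hsplit, h.advectiveDeriv_gluedStress hti htT vℓ x, if_pos hi, hA, hQ]
    simp only [Pi.add_apply, Pi.sub_apply, Pi.smul_apply, smul_add, hg₁, hg₄, hg₅]
    abel
  -- **norms of the scalar factors**
  have habs : ∀ {c M : ℝ}, |c| ≤ M → ‖c‖ₑ ≤ ENNReal.ofReal M := fun hc => by
    rw [← Real.enorm_abs, Real.enorm_eq_ofReal (abs_nonneg _)]
    exact ENNReal.ofReal_le_ofReal hc
  have nθ'' : ‖θ''‖ₑ ≤ ENNReal.ofReal (E₂ * τ⁻¹ ^ 2) := habs (abs_deriv_stepDeriv_le hτ n i t)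
  have nθ' : ‖θ'‖ₑ ≤ ENNReal.ofReal (E₁ * τ⁻¹) := habs (abs_stepDeriv_le hτ n i t)
  have nww' : ‖ww'‖ₑ ≤ ENNReal.ofReal (2 * (E₁ * τ⁻¹)) := habs (abs_deriv_stepWeight_le hτ n i t)
  have nww : ‖ww‖ₑ ≤ 1 := by
    have := habs (abs_stepWeight_le_one τ n i t)
    rwa [ENNReal.ofReal_one] at this
  -- **norms of the six fields**
  -- `g₁ = ℛ wᵢ`: `≤ Ccz |C₃| τ δ ℓ^{-N+α}`
  have n₁ : Torus.eContDiffHolderNorm N (Real.toNNReal α) g₁ ≤ Ccz * ENNReal.ofReal (|C₃| * (τ * δ * ℓ ^ (-(N : ℝ) + α))) :=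
    h.eContDiffHolderNorm_antidivergence_velDiff_le hP ha (hcz N (Nat.le_succ N)) hi hti ((Nat.le_succ N).trans hN)
  -- `g₂ = ℛ BDSV.curl D_{t,ℓ} zᵢ`: `≤ Ccz |C₃| δ ℓ^{-N+α}`
  have n₂ : Torus.eContDiffHolderNorm N (Real.toNNReal α) g₂ ≤ Ccz * ENNReal.ofReal (|C₃| * (δ * ℓ ^ (-(N : ℝ) + α))) :=
    (hcz N (Nat.le_succ N) Dz hDzs).trans (mul_le_mul' le_rfl
      (h.eContDiffHolderNorm_transport_biotSavart_le hP ha hi hti ((Nat.le_succ N).trans hN)))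
  -- `g₃ = [v_ℓ·∇, ℛ BDSV.curl] zᵢ`: `≤ Ccm (V₀ + V₁) |C₃| δ ℓ^{-N+α}`
  have n₃ : Torus.eContDiffHolderNorm N (Real.toNNReal α) g₃ ≤ Ccm * ENNReal.ofReal ((V₀ + V₁) * |C₃| * (δ * ℓ ^ (-(N : ℝ) + α))) :=
    h.eContDiffHolderNorm_commutator_le hP ha hb hβ hα hα1 h213 ((Nat.le_succ N).trans hN) hcm hi hti htT
  -- `g₄ = wᵢ ⊗̊ wᵢ`: `≤ 3^N ‖B‖ (N+1) 4C₃² τ²δ²ℓ^{-N-2+2α}`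
  have n₄ : Torus.eContDiffHolderNorm N (Real.toNNReal α) g₄ ≤
      3 ^ N * ‖B‖ₑ * ((N + 1 : ℕ) * ENNReal.ofReal (4 * C₃ ^ 2 * (τ ^ 2 * δ ^ 2 * ℓ ^ (-(N : ℝ) - 2 + 2 * α)))) :=
    h.eContDiffHolderNorm_tracelessSq_velDiff_le hB hS ha hi hti ((Nat.le_succ N).trans hN)
  -- `g₅ = B(D_{t,ℓ}wᵢ, wᵢ) + B(wᵢ, D_{t,ℓ}wᵢ)`: `≤ 2 · 3^N ‖B‖ (N+1) 4C₃² τδ²ℓ^{-N-2+2α}`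
  have n₅ : Torus.eContDiffHolderNorm N (Real.toNNReal α) g₅ ≤
      2 * (3 ^ N * ‖B‖ₑ * ((N + 1 : ℕ) * ENNReal.ofReal (4 * C₃ ^ 2 * (τ * δ ^ 2 * ℓ ^ (-(N : ℝ) - 2 + 2 * α))))) :=
    h.eContDiffHolderNorm_transition_transport_le hS ha ((Nat.le_succ N).trans hN) hi hti htT
  -- `g₆ = ((v̄ - v_ℓ)·∇)R̊̄`: `≤ 3^N (N+1) |C₃| K' τ δ² ℓ^{-N-2+2α}`
  have n₆ : Torus.eContDiffHolderNorm N (Real.toNNReal α) g₆ ≤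
      3 ^ N * ((N + 1 : ℕ) * ENNReal.ofReal |C₃|) * K' * ENNReal.ofReal (τ * δ ^ 2 * ℓ ^ (-(N : ℝ) - 2 + 2 * α)) :=
    h.eContDiffHolderNorm_convect_gluedStress_le hB hS hP ha hb hβ hα.le hN hcz htT
  -- **the parameter conversions to `X = τ⁻¹ δ ℓ^{-N+α}`**
  have hP2 : τ * δ ^ 2 * ℓ ^ (-(N : ℝ) - 2 + 2 * α) ≤ X := glueScale_mul_amp_succ_sq_mul_rpow_le ha hb hβ hα.le q N
  have hP2' : ENNReal.ofReal (τ * δ ^ 2 * ℓ ^ (-(N : ℝ) - 2 + 2 * α)) ≤ ENNReal.ofReal X := ENNReal.ofReal_le_ofReal hP2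
  -- term 1: `θ'' g₁`
  have T₁ : ‖θ''‖ₑ * Torus.eContDiffHolderNorm N (Real.toNNReal α) g₁ ≤ Ccz * ENNReal.ofReal (E₂ * |C₃|) * ENNReal.ofReal X := by
    calc ‖θ''‖ₑ * Torus.eContDiffHolderNorm N (Real.toNNReal α) g₁
        ≤ ENNReal.ofReal (E₂ * τ⁻¹ ^ 2) * (Ccz * ENNReal.ofReal (|C₃| * (τ * δ * ℓ ^ (-(N : ℝ) + α)))) := mul_le_mul' nθ'' n₁
      _ = Ccz * (ENNReal.ofReal (E₂ * τ⁻¹ ^ 2) * ENNReal.ofReal (|C₃| * (τ * δ * ℓ ^ (-(N : ℝ) + α)))) := by ring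
      _ = Ccz * ENNReal.ofReal (E₂ * |C₃| * X) := by
          rw [← ENNReal.ofReal_mul (by positivity)]
          congr 1; congr 1
          rw [hXdef]; field_simp
      _ = Ccz * ENNReal.ofReal (E₂ * |C₃|) * ENNReal.ofReal X := by
          rw [ENNReal.ofReal_mul (by positivity)]; ring
  -- term 2: `θ' g₂`
  have T₂ : ‖θ'‖ₑ * Torus.eContDiffHolderNorm N (Real.toNNReal α) g₂ ≤ Ccz * ENNReal.ofReal (E₁ * |C₃|) * ENNReal.ofReal X := by
    calc ‖θ'‖ₑ * Torus.eContDiffHolderNorm N (Real.toNNReal α) g₂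
        ≤ ENNReal.ofReal (E₁ * τ⁻¹) * (Ccz * ENNReal.ofReal (|C₃| * (δ * ℓ ^ (-(N : ℝ) + α)))) := mul_le_mul' nθ' n₂
      _ = Ccz * (ENNReal.ofReal (E₁ * τ⁻¹) * ENNReal.ofReal (|C₃| * (δ * ℓ ^ (-(N : ℝ) + α)))) := by ring
      _ = Ccz * ENNReal.ofReal (E₁ * |C₃| * X) := by
          rw [← ENNReal.ofReal_mul (by positivity)]
          congr 1; congr 1
          rw [hXdef]; ring
      _ = Ccz * ENNReal.ofReal (E₁ * |C₃|) * ENNReal.ofReal X := by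
          rw [ENNReal.ofReal_mul (by positivity)]; ring
  -- term 3: `θ' g₃`
  have T₃ : ‖θ'‖ₑ * Torus.eContDiffHolderNorm N (Real.toNNReal α) g₃ ≤
      Ccm * ENNReal.ofReal (E₁ * (V₀ + V₁) * |C₃|) * ENNReal.ofReal X := by
    calc ‖θ'‖ₑ * Torus.eContDiffHolderNorm N (Real.toNNReal α) g₃
        ≤ ENNReal.ofReal (E₁ * τ⁻¹) * (Ccm * ENNReal.ofReal ((V₀ + V₁) * |C₃| * (δ * ℓ ^ (-(N : ℝ) + α)))) := mul_le_mul' nθ' n₃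
      _ = Ccm * (ENNReal.ofReal (E₁ * τ⁻¹) * ENNReal.ofReal ((V₀ + V₁) * |C₃| * (δ * ℓ ^ (-(N : ℝ) + α)))) := by ring
      _ = Ccm * ENNReal.ofReal (E₁ * (V₀ + V₁) * |C₃| * X) := by
          rw [← ENNReal.ofReal_mul (by positivity)]
          congr 1; congr 1
          rw [hXdef]; ring
      _ = Ccm * ENNReal.ofReal (E₁ * (V₀ + V₁) * |C₃|) * ENNReal.ofReal X := by
          rw [ENNReal.ofReal_mul (by positivity)]; ring
  -- term 4: `ww' g₄`
  have T₄ : ‖ww'‖ₑ * Torus.eContDiffHolderNorm N (Real.toNNReal α) g₄ ≤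
      3 ^ N * ‖B‖ₑ * ((N + 1 : ℕ) * ENNReal.ofReal (8 * E₁ * C₃ ^ 2)) * ENNReal.ofReal X := by
    calc ‖ww'‖ₑ * Torus.eContDiffHolderNorm N (Real.toNNReal α) g₄
        ≤ ENNReal.ofReal (2 * (E₁ * τ⁻¹)) * (3 ^ N * ‖B‖ₑ * ((N + 1 : ℕ) * ENNReal.ofReal (4 * C₃ ^ 2 * (τ ^ 2 * δ ^ 2 * ℓ ^ (-(N : ℝ) - 2 + 2 * α))))) :=
          mul_le_mul' nww' n₄
      _ = 3 ^ N * ‖B‖ₑ * ((N + 1 : ℕ) * (ENNReal.ofReal (2 * (E₁ * τ⁻¹)) * ENNReal.ofReal (4 * C₃ ^ 2 * (τ ^ 2 * δ ^ 2 * ℓ ^ (-(N : ℝ) - 2 + 2 * α))))) := by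
          ring
      _ = 3 ^ N * ‖B‖ₑ * ((N + 1 : ℕ) * (ENNReal.ofReal (8 * E₁ * C₃ ^ 2) * ENNReal.ofReal (τ * δ ^ 2 * ℓ ^ (-(N : ℝ) - 2 + 2 * α)))) := by
          rw [← ENNReal.ofReal_mul (by positivity), ← ENNReal.ofReal_mul (by positivity)]
          congr 3
          field_simp
          ring
      _ ≤ 3 ^ N * ‖B‖ₑ * ((N + 1 : ℕ) * (ENNReal.ofReal (8 * E₁ * C₃ ^ 2) * ENNReal.ofReal X)) := by gcongr
      _ = _ := by ring
  -- term 5: `ww g₅`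
  have T₅ : ‖ww‖ₑ * Torus.eContDiffHolderNorm N (Real.toNNReal α) g₅ ≤
      3 ^ N * ‖B‖ₑ * ((N + 1 : ℕ) * ENNReal.ofReal (8 * C₃ ^ 2)) * ENNReal.ofReal X := by
    calc ‖ww‖ₑ * Torus.eContDiffHolderNorm N (Real.toNNReal α) g₅
        ≤ 1 * (2 * (3 ^ N * ‖B‖ₑ * ((N + 1 : ℕ) * ENNReal.ofReal (4 * C₃ ^ 2 * (τ * δ ^ 2 * ℓ ^ (-(N : ℝ) - 2 + 2 * α)))))) :=
          mul_le_mul' nww n₅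
      _ = 3 ^ N * ‖B‖ₑ * ((N + 1 : ℕ) * (2 * ENNReal.ofReal (4 * C₃ ^ 2 * (τ * δ ^ 2 * ℓ ^ (-(N : ℝ) - 2 + 2 * α))))) := by ring
      _ = 3 ^ N * ‖B‖ₑ * ((N + 1 : ℕ) * (ENNReal.ofReal (8 * C₃ ^ 2) * ENNReal.ofReal (τ * δ ^ 2 * ℓ ^ (-(N : ℝ) - 2 + 2 * α)))) := by
          have e8 : (2 : ℝ≥0∞) * ENNReal.ofReal (4 * C₃ ^ 2 * (τ * δ ^ 2 * ℓ ^ (-(N : ℝ) - 2 + 2 * α))) =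
              ENNReal.ofReal (8 * C₃ ^ 2) * ENNReal.ofReal (τ * δ ^ 2 * ℓ ^ (-(N : ℝ) - 2 + 2 * α)) := by
            rw [← ENNReal.ofReal_mul (by positivity), ← ENNReal.ofReal_ofNat 2, ← ENNReal.ofReal_mul (by norm_num)]
            congr 1
            ring
          rw [e8]
      _ ≤ 3 ^ N * ‖B‖ₑ * ((N + 1 : ℕ) * (ENNReal.ofReal (8 * C₃ ^ 2) * ENNReal.ofReal X)) := by gcongr
      _ = _ := by ring
  -- term 6: `g₆`
  have T₆ : Torus.eContDiffHolderNorm N (Real.toNNReal α) g₆ ≤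
      3 ^ N * ((N + 1 : ℕ) * ENNReal.ofReal |C₃|) * K' * ENNReal.ofReal X :=
    n₆.trans (mul_le_mul' le_rfl hP2')
  -- **assembly**
  have hcomb := eContDiffHolderNorm_comb₆_le (r := Real.toNNReal α)
    (hg₁s.isContDiff (n := N) (mod_cast le_top)) (hg₂s.isContDiff (n := N) (mod_cast le_top))
    (hg₃s.isContDiff (n := N) (mod_cast le_top)) (hg₄s.isContDiff (n := N) (mod_cast le_top))
    (hg₅s.isContDiff (n := N) (mod_cast le_top)) (hg₆s.isContDiff (n := N) (mod_cast le_top)) θ'' θ' θ' ww' ww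
  rw [hF]
  refine hcomb.trans ?_
  calc ‖θ''‖ₑ * Torus.eContDiffHolderNorm N (Real.toNNReal α) g₁ + ‖θ'‖ₑ * Torus.eContDiffHolderNorm N (Real.toNNReal α) g₂ +
        ‖θ'‖ₑ * Torus.eContDiffHolderNorm N (Real.toNNReal α) g₃ + ‖ww'‖ₑ * Torus.eContDiffHolderNorm N (Real.toNNReal α) g₄ +
        ‖ww‖ₑ * Torus.eContDiffHolderNorm N (Real.toNNReal α) g₅ + Torus.eContDiffHolderNorm N (Real.toNNReal α) g₆
      ≤ Ccz * ENNReal.ofReal (E₂ * |C₃|) * ENNReal.ofReal X + Ccz * ENNReal.ofReal (E₁ * |C₃|) * ENNReal.ofReal X +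
          Ccm * ENNReal.ofReal (E₁ * (V₀ + V₁) * |C₃|) * ENNReal.ofReal X +
          3 ^ N * ‖B‖ₑ * ((N + 1 : ℕ) * ENNReal.ofReal (8 * E₁ * C₃ ^ 2)) * ENNReal.ofReal X +
          3 ^ N * ‖B‖ₑ * ((N + 1 : ℕ) * ENNReal.ofReal (8 * C₃ ^ 2)) * ENNReal.ofReal X +
          3 ^ N * ((N + 1 : ℕ) * ENNReal.ofReal |C₃|) * K' * ENNReal.ofReal X := by
        gcongr
    _ = (Ccz * ENNReal.ofReal ((E₂ + E₁) * |C₃|) + Ccm * ENNReal.ofReal (E₁ * (V₀ + V₁) * |C₃|) +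
          3 ^ N * ‖B‖ₑ * ((N + 1 : ℕ) * ENNReal.ofReal (8 * (E₁ + 1) * C₃ ^ 2)) +
          3 ^ N * ((N + 1 : ℕ) * ENNReal.ofReal |C₃|) * K') * ENNReal.ofReal X := by
        have e1 : ENNReal.ofReal ((E₂ + E₁) * |C₃|) = ENNReal.ofReal (E₂ * |C₃|) + ENNReal.ofReal (E₁ * |C₃|) := by
          rw [← ENNReal.ofReal_add (by positivity) (by positivity)]; ring_nf
        have e2 : ENNReal.ofReal (8 * (E₁ + 1) * C₃ ^ 2) = ENNReal.ofReal (8 * E₁ * C₃ ^ 2) + ENNReal.ofReal (8 * C₃ ^ 2) := by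
          rw [← ENNReal.ofReal_add (by positivity) (by positivity)]; ring_nf
        rw [e1, e2]
        ring

end TransportBoundDR

end DeRosa

end Literature.Analysis.FluidPDE
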